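import Summits.BirchSwinnertonDyer.BirchSwinnertonDyer.Theorems.ByReductionTypeAtTwoTowerLayerRank
import Literature.NumberTheory.EllipticCurves.IwasawaSelmerControlCokerProofs
import HarnessLib

/-!
# `X/(p, ω_n)X` is Pontryagin dual to `A_n[p]`: the EXACT finite-layer count
# `#X/(p, T^{pⁿ})X = #A_n[p]`, `A_n = h_n⁻¹(Sel_{p^∞}(E/K_∞)) ⊆ H¹(K_n, E[p^∞])`
# (route ByReductionTypeAtTwo, crux `OrdKatoHalfAtTwo`, item stmt-BirchSwinnertonDyer-19271;
# seat bsd-2adic-tower-1, D-0074 (T1) «[2]-level control at p = 2», part 2 of 3)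

HONEST FRAMING (cell `bsd-2adic`, run/shared/lean/pub/bsd-2adic/, HUMAN RULINGS D-0036/D-0074): THEOREMS
ONLY; nothing asserted; no definition; no new named fact; closes nothing by itself. Any prime `p`, any
number field `K`, any `ℤ_p`-extension `κ`; `p = 2` over `ℚ` is the consumer (part 3, the gap bridge).

The TOWER doors (`Theorems/ByReductionTypeAtTwoTowerLambdaRank.lean`, `…TowerLayerRank.lean`) carry the
whole algebraic input of the `2`-adic main conjecture on a curve with odd torsion order by the numbers
`a_m = dim_{𝔽₂} X/(2, T^m)X`: the RANK certificate wants a LOWER bound on one `a_{2^j}` (part 1: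
`a_{2^j} ≥ dim Sel_{2^∞}(E/ℚ_j)[2]`), the GAP certificate `O1.TowerGapAtTwo W` wants in addition an UPPER
bound on one `a_{2^{j'}}`. This file identifies `a_{pⁿ}` EXACTLY with a finite-layer object:

* §1 (the Pontryagin step at layer `n`, any `γ`): for a dual datum `D` over `(κ, γ)` with `X = D.X`
  finitely generated, a class `x ∈ X` whose character `toDual x` kills every `p`-torsion class of
  `Sel_∞ = Sel_{p^∞}(E/K_∞)` fixed by `conj_{γ^{pⁿ}}` lies in `I_n X`, `I_n = (p, (1+T)^{pⁿ} − 1) = (p, ω_n)`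
  (`mem_layerIdeal_smul_top_of_forall_toDual_apply_eq_zero`: the character factors through
  `s ↦ (p s, (conj_γ^{pⁿ} − 1) s)` and extends by the injectivity of `ℚ/ℤ`, exactly as the tree's
  layer-`0` `IwasawaDual.IsDualPair.mem_mPow_one_of_mem_annPiece`); with the tree's converse pairing
  (`X1.GeneratorCountLayer.card_le_natCard_quotient_layerIdeal`) this gives the EQUALITY
  `natCard_quotient_layerIdeal_eq`: **`#X/I_n X = #{s ∈ Sel_∞ | p s = 0, conj_{γ^{pⁿ}} s = s}`**.
* §2 (the layer): for `γ` a topological generator and `E(K)[p] = 0`, restriction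
  `h_n : H¹(K_n, E[p^∞]) → H¹(K_∞, E[p^∞])` is injective (`Additive.layerToInfty_injective_of_no_pTorsion`)
  and hits every class fixed by `conj_{γ^{pⁿ}}` (Greenberg's Lemma 3.2 in its sharp tree form
  `ZpExtension.mem_range_resOfLe_of_conjH1_eq`, any `ℤ_p`-extension), so `A_n[p]` is in bijection with
  that set: **`natCard_quotient_towerIdeal_eq_natCard_layerClasses`: `#X/(p, T^{pⁿ})X = #A_n[p]`**.
* NOT here (part 3, `…TowerLayerGap.lean`): the local error terms — `A_n[p] / Sel_{p^∞}(E/K_n)[p]`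
  embeds by Greenberg's evaluation map (Lemma 3.5, p. 90) into the product of the `p`-torsion of the
  local tower kernels `𝒦_{v,n}` over the primes of `K_n` above the bad primes and `p` — and the gap
  bridge `O1.TowerGapAtTwo W` at `p = 2`.

References: R. Greenberg, LNM 1716 (1999), §1 p. 60 (`X/𝔪X` dual to `Sel[𝔪]`), §3 pp. 85–86
(`A_n`, Lemmas 3.1, 3.2), p. 90 (Lemma 3.5, `E(F)[p] = 0 ⇒ s_n` injective); L. Washington,
*Introduction to Cyclotomic Fields*, §13.2 (`ω_n`); J.-P. Serre, *Galois Cohomology*, I.§2.6.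
-/

set_option autoImplicit false

noncomputable section

open scoped Classical

open WeierstrassCurve Literature.NumberTheory.EllipticCurves Literature.NumberTheory.EllipticCurves.IwasawaDual
  PowerSeries Summit.BirchSwinnertonDyer.Rank1Residual Summit.BirchSwinnertonDyer.Rank1Residual.X5.TowerGap

universe u

namespace Summit.BirchSwinnertonDyer.BirchSwinnertonDyer.Theorems.TowerLayer

/-! ## §1 The Pontryagin step at layer `n` -/

section Pairing

variable {K : Type u} [Field K] [NumberField K] {W : WeierstrassCurve K} {p : ℕ} [hp : Fact p.Prime]
  {κ : ZpExtension K p} {γ : Field.absoluteGaloisGroup K} (D : W.SelmerDualData κ γ)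

/-- `(C p · x)(s) = x(p · s)`: the constant `p ∈ Λ` acts through the `ℕ`-action. [folklore] -/
theorem toDual_C_natCast_smul_apply (x : D.X) (s : W.selmerInfty κ) :
    D.toDual ((C (p : ℤ_[p]) : IwasawaAlgebra p) • x) s = D.toDual x (p • s) := by
  rw [map_natCast, Nat.cast_smul_eq_nsmul, map_nsmul, AddMonoidHom.nsmul_apply, map_nsmul]

/-- **The Pontryagin step at layer `n` (upper half of the duality).** For ANY dual datum `D` over
`(κ, γ)` and any `n`: if the character `toDual x` of `x ∈ X` kills every `p`-torsion class
`s ∈ Sel_{p^∞}(E/K_∞)` fixed by `conj_{γ^{pⁿ}}`, then `x ∈ I_n X`, `I_n = (p, (1+T)^{pⁿ} − 1)`. The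
character kills `ker (s ↦ (p·s, conj_{γ^{pⁿ}} s − s))`, so it factors through the image in `S × S` and
extends to `S × S` (injectivity of `ℚ/ℤ`, Mathlib `CharacterModule.dual_surjective_of_injective`) as
`(y₁, y₂)`; with `yᵢ = toDual xᵢ` one gets `x = p·x₁ + ω_n·x₂` (`(ω_n·x₂)(s) = x₂(conj_{γ^{pⁿ}} s) − x₂(s)`,
`X1.GeneratorCountLayer.toDual_one_add_X_pow_smul`). The layer-`0` case is the tree's
`IsDualPair.mem_mPow_one_of_mem_annPiece`. [cite: GreenbergLNM1716, §1 p. 60] -/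
theorem mem_layerIdeal_smul_top_of_forall_toDual_apply_eq_zero (n : ℕ) {x : D.X}
    (hx : ∀ s : W.selmerInfty κ, p • s = 0 →
      W.conjH1 p κ.kerSubgroup (γ ^ p ^ n) (s : W.subgroupH1 p κ.kerSubgroup) = s → D.toDual x s = 0) :
    x ∈ Ideal.span {(C (p : ℤ_[p]) : IwasawaAlgebra p), (1 + (X : IwasawaAlgebra p)) ^ p ^ n - 1} •
      (⊤ : Submodule (IwasawaAlgebra p) D.X) := by
  -- `φ = conj_γ^{pⁿ}` on `S = Sel_∞`, `δ s = (p s, φ s − s)`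
  let φ : ↥(W.selmerInfty κ) →+ ↥(W.selmerInfty κ) := (W.conjSelmerInfty κ γ) ^ p ^ n
  have hφ : ∀ s : W.selmerInfty κ, ((φ s : W.selmerInfty κ) : W.subgroupH1 p κ.kerSubgroup) =
      W.conjH1 p κ.kerSubgroup (γ ^ p ^ n) s := fun s ↦ W.coe_conjSelmerInfty_pow_apply κ γ (p ^ n) s
  let δ : ↥(W.selmerInfty κ) →+ ↥(W.selmerInfty κ) × ↥(W.selmerInfty κ) :=
    (DistribSMul.toAddMonoidHom _ p).prod (φ - AddMonoidHom.id _)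
  have hδ : ∀ s, δ s = (p • s, φ s - s) := fun s ↦ rfl
  have hker : δ.rangeRestrict.ker ≤ (D.toDual x).ker := by
    intro s hs
    rw [AddMonoidHom.mem_ker] at hs ⊢
    have hs' : δ s = 0 := congrArg (fun z : δ.range ↦ (z : ↥(W.selmerInfty κ) × ↥(W.selmerInfty κ))) hs
    rw [hδ, Prod.mk_eq_zero, sub_eq_zero] at hs'
    refine hx s hs'.1 ?_
    rw [← hφ s, hs'.2]
  have hsurj : Function.Surjective δ.rangeRestrict := AddMonoidHom.rangeRestrict_surjective δ
  let χ' : δ.range →+ AddCircle (1 : ℚ) := δ.rangeRestrict.liftOfSurjective hsurj ⟨D.toDual x, hker⟩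
  have hχ' : ∀ s, χ' (δ.rangeRestrict s) = D.toDual x s := fun s ↦
    AddMonoidHom.liftOfRightInverse_comp_apply _ _ _ _ s
  obtain ⟨y, hy⟩ := CharacterModule.dual_surjective_of_injective
    (δ.range.subtype.toIntLinearMap) (fun a b hab ↦ Subtype.ext hab) χ'
  have hy' : ∀ g : δ.range, y g = χ' g := fun g ↦ by
    have := DFunLike.congr_fun hy g
    rw [CharacterModule.dual_apply] at this
    exact this
  let y₀ : ↥(W.selmerInfty κ) × ↥(W.selmerInfty κ) →+ AddCircle (1 : ℚ) := y
  let y₁ : ↥(W.selmerInfty κ) →+ AddCircle (1 : ℚ) := y₀.comp (AddMonoidHom.inl _ _)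
  let y₂ : ↥(W.selmerInfty κ) →+ AddCircle (1 : ℚ) := y₀.comp (AddMonoidHom.inr _ _)
  have hsplit : ∀ s, D.toDual x s = y₁ (p • s) + y₂ (φ s - s) := by
    intro s
    have e1 : D.toDual x s = y₀ ((δ.rangeRestrict s : δ.range) : _ × _) := by
      rw [← hχ' s, ← hy']
      rfl
    rw [e1]
    change y₀ (δ s) = y₀ (p • s, 0) + y₀ (0, φ s - s)
    rw [← map_add, Prod.mk_add_mk, add_zero, zero_add, hδ]
  obtain ⟨x₁, hx₁⟩ := D.bijective.2 y₁
  obtain ⟨x₂, hx₂⟩ := D.bijective.2 y₂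
  have hx12 : x = (C (p : ℤ_[p]) : IwasawaAlgebra p) • x₁ +
      ((1 + (X : IwasawaAlgebra p)) ^ p ^ n - 1) • x₂ := by
    apply D.bijective.1
    ext s
    rw [map_add, AddMonoidHom.add_apply, toDual_C_natCast_smul_apply, sub_smul, one_smul, map_sub,
      AddMonoidHom.sub_apply, X1.GeneratorCountLayer.toDual_one_add_X_pow_smul, hx₁, hx₂, hsplit,
      map_sub]
    rfl
  rw [hx12]
  exact Submodule.add_mem _ (Submodule.smul_mem_smul (Ideal.subset_span (by simp)) Submodule.mem_top)
    (Submodule.smul_mem_smul (Ideal.subset_span (by simp)) Submodule.mem_top)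

/-- **`Sel_∞[p]^{γ^{pⁿ}}` is finite** when `X` is finitely generated: distinct `p`-torsion
`γ^{pⁿ}`-fixed classes are counted by the finite group `X/I_n X`
(`X1.GeneratorCountLayer.card_le_natCard_quotient_layerIdeal`). [cite: GreenbergLNM1716, §1 p. 60] -/
theorem finite_fixedPTorsion [Module.Finite (IwasawaAlgebra p) D.X] (n : ℕ) :
    Finite {s : W.selmerInfty κ // p • s = 0 ∧
      W.conjH1 p κ.kerSubgroup (γ ^ p ^ n) (s : W.subgroupH1 p κ.kerSubgroup) = s} := by
  by_contra hinf
  rw [not_finite_iff_infinite] at hinf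
  set N := Nat.card (D.X ⧸ Ideal.span {(C (p : ℤ_[p]) : IwasawaAlgebra p),
    (1 + (X : IwasawaAlgebra p)) ^ p ^ n - 1} • (⊤ : Submodule (IwasawaAlgebra p) D.X)) with hN
  obtain ⟨t, ht⟩ := Infinite.exists_subset_card_eq {s : W.selmerInfty κ // p • s = 0 ∧
      W.conjH1 p κ.kerSubgroup (γ ^ p ^ n) (s : W.subgroupH1 p κ.kerSubgroup) = s} (N + 1)
  have hle := X1.GeneratorCountLayer.card_le_natCard_quotient_layerIdeal D n
    (t.map (Function.Embedding.subtype _)) fun s hs ↦ by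
      obtain ⟨z, -, rfl⟩ := Finset.mem_map.mp hs
      exact z.2
  rw [Finset.card_map, ht] at hle
  omega

/-- **The duality count at layer `n` (EQUALITY): `#X/I_n X = #{s ∈ Sel_∞ | p·s = 0, conj_{γ^{pⁿ}} s = s}`**,
`I_n = (p, (1+T)^{pⁿ} − 1)`, for every dual datum `D` over `(κ, γ)` with `X = D.X` finitely generated
(any `ℤ_p`-extension, any `γ`). `≥` is the tree's pairing; `≤`: `x mod I_n X ↦ (s ↦ x(s))` is an
injective map `X/I_n X ↪ Hom(S_n, ℚ/ℤ)` (§1) and `#Hom(S_n, ℚ/ℤ) = #S_n` for the finite group `S_n`.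
[cite: GreenbergLNM1716, §1 p. 60] -/
theorem natCard_quotient_layerIdeal_eq [Module.Finite (IwasawaAlgebra p) D.X] (n : ℕ) :
    Nat.card (D.X ⧸ Ideal.span {(C (p : ℤ_[p]) : IwasawaAlgebra p),
        (1 + (X : IwasawaAlgebra p)) ^ p ^ n - 1} • (⊤ : Submodule (IwasawaAlgebra p) D.X)) =
      Nat.card {s : W.selmerInfty κ // p • s = 0 ∧
        W.conjH1 p κ.kerSubgroup (γ ^ p ^ n) (s : W.subgroupH1 p κ.kerSubgroup) = s} := by
  haveI hfin := finite_fixedPTorsion D n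
  set I := Ideal.span {(C (p : ℤ_[p]) : IwasawaAlgebra p),
    (1 + (X : IwasawaAlgebra p)) ^ p ^ n - 1} with hI
  set N : Submodule (IwasawaAlgebra p) D.X := I • ⊤ with hN
  -- the subgroup `T = Sel_∞[p]^{γ^{pⁿ}}`
  let T : AddSubgroup (W.selmerInfty κ) :=
    { carrier := {s | p • s = 0 ∧
        W.conjH1 p κ.kerSubgroup (γ ^ p ^ n) (s : W.subgroupH1 p κ.kerSubgroup) = s}
      zero_mem' := ⟨smul_zero _, by simp⟩
      add_mem' := by
        rintro a b ⟨ha, ha'⟩ ⟨hb, hb'⟩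
        exact ⟨by rw [smul_add, ha, hb, add_zero], by
          rw [AddSubgroup.coe_add, map_add, ha', hb']⟩
      neg_mem' := by
        rintro a ⟨ha, ha'⟩
        exact ⟨by rw [smul_neg, ha, neg_zero], by rw [AddSubgroup.coe_neg, map_neg, ha']⟩ }
  have hTmem : ∀ s : W.selmerInfty κ, s ∈ T ↔ p • s = 0 ∧
      W.conjH1 p κ.kerSubgroup (γ ^ p ^ n) (s : W.subgroupH1 p κ.kerSubgroup) = s := fun _ ↦ Iff.rfl
  let eT : T ≃ {s : W.selmerInfty κ // p • s = 0 ∧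
      W.conjH1 p κ.kerSubgroup (γ ^ p ^ n) (s : W.subgroupH1 p κ.kerSubgroup) = s} :=
    Equiv.subtypeEquivRight hTmem
  haveI : Finite T := Finite.of_equiv _ eT.symm
  apply le_antisymm
  · -- `≤`: `X/N ↪ Hom(T, ℚ/ℤ)`
    haveI : Finite (CharacterModule T) := PontryaginCard.finite_characterModule_of_finite T
    let res : (↥(W.selmerInfty κ) →+ AddCircle (1 : ℚ)) →+ CharacterModule T :=
      { toFun := fun f ↦ f.comp T.subtype
        map_zero' := rfl
        map_add' := fun _ _ ↦ rfl }
    let f : D.X →+ CharacterModule T := res.comp D.toDual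
    have hf : ∀ (x : D.X) (s : T), f x s = D.toDual x s := fun _ _ ↦ rfl
    have hfN : ∀ x ∈ N.toAddSubgroup, f x = 0 := by
      intro x hx
      ext s
      rw [hf]
      exact X1.GeneratorCountLayer.toDual_apply_eq_zero_of_mem_layerIdeal_smul_top D n hx s s.2.1 s.2.2
    let Φ : D.X ⧸ N → CharacterModule T := fun q ↦ QuotientAddGroup.lift N.toAddSubgroup f hfN q
    have hΦ_mk : ∀ x : D.X, Φ (Submodule.Quotient.mk x) = f x := fun _ ↦ rfl
    have hΦ : Function.Injective Φ := by
      intro q q'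
      induction q using Submodule.Quotient.induction_on with | _ x => ?_
      induction q' using Submodule.Quotient.induction_on with | _ x' => ?_
      intro h
      rw [hΦ_mk, hΦ_mk] at h
      rw [Submodule.Quotient.eq]
      refine mem_layerIdeal_smul_top_of_forall_toDual_apply_eq_zero D n fun s hs hs' ↦ ?_
      have := DFunLike.congr_fun h ⟨s, hs, hs'⟩
      rw [hf, hf] at this
      rw [map_sub, AddMonoidHom.sub_apply, this, sub_self]
    calc Nat.card (D.X ⧸ N) ≤ Nat.card (CharacterModule T) := Nat.card_le_card_of_injective Φ hΦ
      _ = Nat.card T := PontryaginCard.natCard_characterModule_of_finite T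
      _ = _ := Nat.card_congr eT
  · -- `≥`: the tree's pairing
    haveI := Fintype.ofFinite {s : W.selmerInfty κ // p • s = 0 ∧
      W.conjH1 p κ.kerSubgroup (γ ^ p ^ n) (s : W.subgroupH1 p κ.kerSubgroup) = s}
    have hle := X1.GeneratorCountLayer.card_le_natCard_quotient_layerIdeal D n
      ((Finset.univ : Finset {s : W.selmerInfty κ // p • s = 0 ∧
        W.conjH1 p κ.kerSubgroup (γ ^ p ^ n) (s : W.subgroupH1 p κ.kerSubgroup) = s}).map
        (Function.Embedding.subtype _)) fun s hs ↦ by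
        obtain ⟨z, -, rfl⟩ := Finset.mem_map.mp hs
        exact z.2
    rwa [Finset.card_map, Finset.card_univ, ← Nat.card_eq_fintype_card] at hle

end Pairing

/-! ## §2 The layer: `#X/(p, T^{pⁿ})X = #A_n[p]` -/

section Layer

variable {K : Type u} [Field K] [NumberField K] (W : WeierstrassCurve K) [W.IsElliptic] {p : ℕ}
  [hp : Fact p.Prime] (κ : ZpExtension K p) {γ : Field.absoluteGaloisGroup K}

/-- **`A_n[p] ≃ Sel_∞[p]^{γ^{pⁿ}}` via `h_n`.** For `γ` a topological generator and `E(K)[p] = 0`: the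
restriction `h_n` is injective (`Additive.layerToInfty_injective_of_no_pTorsion`), carries `A_n = h_n⁻¹(Sel_∞)`
into `Sel_∞` with `Gal(K̄/K_n)`-fixed image (`range_layerToInfty_le_layerInvariants_holds`,
`γ^{pⁿ} ∈ Gal(K̄/K_n)`), and reaches every class fixed by `conj_{γ^{pⁿ}}` (the tree's sharp Lemma 3.2,
`ZpExtension.mem_range_resOfLe_of_conjH1_eq`, any `ℤ_p`-extension). So `z ↦ h_n z` is a bijection from
the `p`-torsion of `A_n` onto the `p`-torsion `γ^{pⁿ}`-fixed classes of `Sel_∞`.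
[cite: GreenbergLNM1716, §3 pp. 85–86 (Lemmas 3.1, 3.2) and p. 90] -/
theorem natCard_layerClasses_eq_natCard_fixedPTorsion (hγ : κ.IsTopGenerator γ)
    (hK : ∀ P : W.toAffine.Point, p • P = 0 → P = 0) (n : ℕ) :
    Nat.card {z : W.selmerInftyPreimage κ n // p • z = 0} =
      Nat.card {s : W.selmerInfty κ // p • s = 0 ∧
        W.conjH1 p κ.kerSubgroup (γ ^ p ^ n) (s : W.subgroupH1 p κ.kerSubgroup) = s} := by
  let g : {z : W.selmerInftyPreimage κ n // p • z = 0} → {s : W.selmerInfty κ // p • s = 0 ∧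
      W.conjH1 p κ.kerSubgroup (γ ^ p ^ n) (s : W.subgroupH1 p κ.kerSubgroup) = s} := fun z ↦
    ⟨⟨W.layerToInfty κ n (z.1 : W.subgroupH1 p (κ.layerSubgroup n)), z.1.2⟩, by
      refine ⟨Subtype.ext ?_, ?_⟩
      · have hz : ((p • z.1 : W.selmerInftyPreimage κ n) : W.subgroupH1 p (κ.layerSubgroup n)) = 0 := by
          rw [z.2]; rfl
        change p • W.layerToInfty κ n (z.1 : W.subgroupH1 p (κ.layerSubgroup n)) = 0
        rw [← map_nsmul, ← AddSubgroup.coe_nsmul, hz, map_zero]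
      · have hmem : W.layerToInfty κ n (z.1 : W.subgroupH1 p (κ.layerSubgroup n)) ∈
            W.layerInvariants κ n :=
          W.range_layerToInfty_le_layerInvariants_holds κ n ⟨_, rfl⟩
        rw [mem_layerInvariants_iff] at hmem
        exact hmem _ (X1.GeneratorCountLayer.pow_mem_layerSubgroup κ γ n)⟩
  have hg_coe : ∀ z, (((g z).1 : W.selmerInfty κ) : W.subgroupH1 p κ.kerSubgroup) =
      W.layerToInfty κ n (z.1 : W.subgroupH1 p (κ.layerSubgroup n)) := fun _ ↦ rfl
  refine Nat.card_congr (Equiv.ofBijective g ⟨?_, ?_⟩)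
  · intro z z' h
    have h' := congrArg (fun s ↦ ((s.1 : W.selmerInfty κ) : W.subgroupH1 p κ.kerSubgroup)) h
    simp only [hg_coe] at h'
    exact Subtype.ext (Subtype.ext (Additive.layerToInfty_injective_of_no_pTorsion W κ hK n h'))
  · rintro ⟨s, hps, hfix⟩
    have hprim : ∀ m : geomPrimaryTorsion W p, ∃ k : ℕ, p ^ k • m = 0 := fun m ↦ by
      obtain ⟨k, hk⟩ := m.2
      exact ⟨k, Subtype.ext (by rw [AddSubgroupClass.coe_nsmul, hk, ZeroMemClass.coe_zero])⟩
    obtain ⟨y, hy⟩ : (s : W.subgroupH1 p κ.kerSubgroup) ∈ (W.layerToInfty κ n).range :=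
      ZpExtension.mem_range_resOfLe_of_conjH1_eq κ hγ n (W.continuous_smul_geomPrimaryTorsion p)
        hprim _ hfix
    have hyA : y ∈ W.selmerInftyPreimage κ n := by
      rw [mem_selmerInftyPreimage_iff, hy]; exact s.2
    have hpy : p • (⟨y, hyA⟩ : W.selmerInftyPreimage κ n) = 0 := by
      apply Subtype.ext
      change p • y = 0
      apply Additive.layerToInfty_injective_of_no_pTorsion W κ hK n
      rw [map_nsmul, hy, map_zero, ← AddSubgroup.coe_nsmul, hps, AddSubgroup.coe_zero]
    refine ⟨⟨⟨y, hyA⟩, hpy⟩, Subtype.ext (Subtype.ext ?_)⟩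
    rw [hg_coe]
    exact hy

/-- **THE FINITE-LAYER COUNT: `#X/(p, T^{pⁿ})X = #A_n[p]`.** For an elliptic curve `E = W` over a
number field `K` with `E(K)[p] = 0`, ANY `ℤ_p`-extension `κ` with topological generator `γ`, any
Pontryagin-dual datum `D` of `Sel_{p^∞}(E/K_∞)` over `(κ, γ)` with `X = D.X` finitely generated, and any
layer `n`: the number of `p`-torsion classes of `A_n = h_n⁻¹(Sel_{p^∞}(E/K_∞)) ⊆ H¹(K_n, E[p^∞])`
(`selmerInftyPreimage κ n` — the `p`-torsion of the generalised Selmer group of `E` over `K_n` with the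
local conditions induced from `K_∞`) equals `#X/(p, T^{pⁿ})X` (`= #X/(p, ω_n)X = #(X/pX)_{Γ_n}`). §1 + §2 +
`(p, ω_n) = (p, T^{pⁿ})`. [cite: GreenbergLNM1716, §1 p. 60, §3 pp. 85–86, p. 90] -/
theorem natCard_quotient_towerIdeal_eq_natCard_layerClasses (D : W.SelmerDualData κ γ)
    [Module.Finite (IwasawaAlgebra p) D.X] (hγ : κ.IsTopGenerator γ)
    (hK : ∀ P : W.toAffine.Point, p • P = 0 → P = 0) (n : ℕ) :
    Nat.card (D.X ⧸ (towerIdeal p (p ^ n) • ⊤ : Submodule (IwasawaAlgebra p) D.X)) =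
      Nat.card {z : W.selmerInftyPreimage κ n // p • z = 0} := by
  rw [← KatoHalfPinch.layerIdeal_eq_towerIdeal, natCard_quotient_layerIdeal_eq D n,
    natCard_layerClasses_eq_natCard_fixedPTorsion W κ hγ hK n]

/-- **`A_n[p]` is finite** (`E(K)[p] = 0`, `X` finitely generated, any `γ`): distinct `p`-torsion
classes of `A_n` are counted by the finite group `X/I_n X`
(`X1.GeneratorCountLayer.card_le_natCard_quotient_layerIdeal_of_layerClasses`).
[cite: GreenbergLNM1716, §3 p. 90] -/
theorem finite_layerClasses (D : W.SelmerDualData κ γ) [Module.Finite (IwasawaAlgebra p) D.X]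
    (hK : ∀ P : W.toAffine.Point, p • P = 0 → P = 0) (n : ℕ) :
    Finite {z : W.selmerInftyPreimage κ n // p • z = 0} := by
  by_contra hinf
  rw [not_finite_iff_infinite] at hinf
  set N := Nat.card (D.X ⧸ Ideal.span {(C (p : ℤ_[p]) : IwasawaAlgebra p),
    (1 + (X : IwasawaAlgebra p)) ^ p ^ n - 1} • (⊤ : Submodule (IwasawaAlgebra p) D.X)) with hN
  obtain ⟨t, ht⟩ := Infinite.exists_subset_card_eq {z : W.selmerInftyPreimage κ n // p • z = 0} (N + 1)
  have hle := X1.GeneratorCountLayer.card_le_natCard_quotient_layerIdeal_of_layerClasses D hK n t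
  omega

end Layer

end Summit.BirchSwinnertonDyer.BirchSwinnertonDyer.Theorems.TowerLayer

end
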